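import Mathlib
import Summits.NavierStokesRegularity.NavierStokesRegularity.Theorems.EulerZoomLiouvillePowerGaugeEulerLiouvilleKillingRotation
import Summits.NavierStokesRegularity.NavierStokesRegularity.Theorems.EulerZoomLiouvillePowerGaugeEulerLiouvilleKillingScrew
import Summits.NavierStokesRegularity.NavierStokesRegularity.Theorems.EulerZoomLiouvillePowerGaugeEulerLiouvilleGalileanHarmonicShear
import HarnessLib

/-!
# GENERAL KILLING FIELDS: recentring to screw form and the invariance of the profile
# (crux `EulerZoomLiouville.PowerGaugeEulerLiouville` = stmt-NavierStokesRegularity-19832; «E(3)-steady, escaping» stratum, step (iv); width seat ns-ezl-w3 g5)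

Route №10 `EulerZoomLiouville`, crux E.  The two-time identity of a rigid-frame-steady member (`RigidFrame.bodyFrame_twoTime`) says that the Lie derivative of
the profile `U` along a GENERAL Killing field `κ(w) = Bw + b` (`B` skew) is weakly a gradient.  `Killing.screwShearVanishes` wants the SCREW normal form `Bb = 0`.
This file bridges the two:

* `RigidFrame.exists_screw_recentring` — for skew `B` and any `b` there are `y₀`, `b′` with `B b′ = 0` and `b = b′ − B y₀` (`ℝ³ = range B ⊕ ker B`, the
  range of a skew map being the orthogonal complement of its kernel); i.e. `κ(w) = B(w − y₀) + b′` is a screw about the axis through `y₀`;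
* `RigidFrame.killing_invariance` — if `U ∈ L¹_loc` is weakly divergence-free with the `A`-gauge slice growth `∫⁻_{B_R}‖U‖² ≤ C R^{1−2ρ}` and
  `∫ ⟪U, DΦ(z)(Bz + b) − BΦ(z)⟫ = 0` for all smooth compactly supported trace-free `Φ`, then with `y₀, b′` as above the recentred profile `U(· + y₀)` is
  invariant under the screw motions `z ↦ exp(θB) z + θ b′`: `exp(−θB) U(exp(θB) z + θ b′ + y₀) = U(z + y₀)` a.e., every `θ` — i.e. `U` is invariant under the
  one-parameter group of rigid motions generated by `κ`.

WHAT THIS IS NOT: not NS regularity, not the crux E — a stratum tool of the crux CLASS 19832 (MODEL lattice; E/NS strata), `--supports` stmt-19832; 19832 OPEN.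
[folklore]
-/

noncomputable section

-- flat `Theorems/<Route><Decl>…` files of one crux share the namespace of the crux (tree convention: `Summit.<S>.<S>.…`)
set_option linter.dupNamespace false

open MeasureTheory Set Filter Topology Metric Function TopologicalSpace InnerProductSpace
open scoped ENNReal NNReal RealInnerProductSpace ContDiff

namespace Summit.NavierStokesRegularity.NavierStokesRegularity.Theorems.PowerGaugeEulerLiouville

namespace RigidFrame

open Literature.Analysis Literature.Analysis.FunctionSpaces Literature.Analysis.FluidPDE
open Summit.NavierStokesRegularity.NavierStokesRegularity.Theorems.PowerGaugeEulerLiouville.GalileanFrames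
open Summit.NavierStokesRegularity.NavierStokesRegularity.Theorems.PowerGaugeEulerLiouville.Killing

/-- **Recentring a Killing field to screw form**: for skew `B` and any `b` there are `y₀`, `b′` with `B b′ = 0` and `b = b′ − B y₀`
(`ℝ³ = range B ⊕ (range B)ᗮ` and `(range B)ᗮ = ker B` for skew `B`). [folklore] -/
theorem exists_screw_recentring (B : EuclideanSpace ℝ (Fin 3) →L[ℝ] EuclideanSpace ℝ (Fin 3))
    (hB : ∀ x : EuclideanSpace ℝ (Fin 3), ⟪B x, x⟫ = 0) (b : EuclideanSpace ℝ (Fin 3)) :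
    ∃ y₀ b' : EuclideanSpace ℝ (Fin 3), B b' = 0 ∧ b = b' - B y₀ := by
  set K : Submodule ℝ (EuclideanSpace ℝ (Fin 3)) := LinearMap.range (B : EuclideanSpace ℝ (Fin 3) →ₗ[ℝ] EuclideanSpace ℝ (Fin 3))
    with hK
  have hsup : K ⊔ Kᗮ = ⊤ := Submodule.sup_orthogonal_of_hasOrthogonalProjection
  have hb : b ∈ K ⊔ Kᗮ := by rw [hsup]; exact Submodule.mem_top
  obtain ⟨y, hy, z, hz, hyz⟩ := Submodule.mem_sup.1 hb
  obtain ⟨y₁, hy₁⟩ := LinearMap.mem_range.1 hy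
  have hBz : B z = 0 := by
    have h1 : ∀ v : EuclideanSpace ℝ (Fin 3), ⟪B v, z⟫ = 0 := fun v =>
      (Submodule.mem_orthogonal K z).1 hz (B v) (LinearMap.mem_range.2 ⟨v, rfl⟩)
    have h2 : ⟪B z, B z⟫ = 0 := by
      rw [inner_skew_swap hB z (B z), real_inner_comm, h1, neg_zero]
    exact inner_self_eq_zero.1 h2
  refine ⟨-y₁, z, hBz, ?_⟩
  have hy₁' : B y₁ = y := hy₁
  rw [map_neg, hy₁', sub_neg_eq_add, add_comm]
  exact hyz.symm

/-- Growth about a shifted centre: `∫⁻_{B_R}‖U(· + y₀)‖² ≤ C′ R^{m}` for `R ≥ 1` if `∫⁻_{B_R}‖U‖² ≤ C R^{m}` for `R ≥ 1`. [folklore] -/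
theorem growth_comp_add {U : EuclideanSpace ℝ (Fin 3) → EuclideanSpace ℝ (Fin 3)} {C m : ℝ}
    (hgrow : ∀ R : ℝ, 1 ≤ R → ∫⁻ z in ball (0 : EuclideanSpace ℝ (Fin 3)) R, ‖U z‖ₑ ^ 2 ≤ ENNReal.ofReal (C * R ^ m))
    (y₀ : EuclideanSpace ℝ (Fin 3)) :
    ∀ R : ℝ, 1 ≤ R → ∫⁻ z in ball (0 : EuclideanSpace ℝ (Fin 3)) R, ‖U (z + y₀)‖ₑ ^ 2 ≤
      ENNReal.ofReal (max C 0 * max 1 ((1 + ‖y₀‖) ^ m) * R ^ m) := by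
  intro R hR
  have hR0 : 0 < R := by linarith
  rw [setLIntegral_ball_comp_add_right (fun y => ‖U y‖ₑ ^ 2) y₀ R]
  have hsub : ball y₀ R ⊆ ball (0 : EuclideanSpace ℝ (Fin 3)) (R + ‖y₀‖) := by
    intro y hy
    rw [mem_ball, dist_eq_norm] at hy
    rw [mem_ball_zero_iff]
    calc ‖y‖ ≤ ‖y - y₀‖ + ‖y₀‖ := norm_le_norm_sub_add y y₀
      _ < R + ‖y₀‖ := by linarith
  refine (lintegral_mono_set hsub).trans ((hgrow (R + ‖y₀‖) (by linarith [norm_nonneg y₀])).trans (ENNReal.ofReal_le_ofReal ?_))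
  -- `(R + ‖y₀‖)^m ≤ max 1 ((1+‖y₀‖)^m) R^m`
  have hRm : 0 < R ^ m := Real.rpow_pos_of_pos hR0 m
  have hpow : (R + ‖y₀‖) ^ m ≤ max 1 ((1 + ‖y₀‖) ^ m) * R ^ m := by
    rcases le_or_gt 0 m with hm | hm
    · have h1 : R + ‖y₀‖ ≤ (1 + ‖y₀‖) * R := by nlinarith [norm_nonneg y₀]
      calc (R + ‖y₀‖) ^ m ≤ ((1 + ‖y₀‖) * R) ^ m := Real.rpow_le_rpow (by linarith [norm_nonneg y₀]) h1 hm
        _ = (1 + ‖y₀‖) ^ m * R ^ m := Real.mul_rpow (by linarith [norm_nonneg y₀]) hR0.le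
        _ ≤ max 1 ((1 + ‖y₀‖) ^ m) * R ^ m := mul_le_mul_of_nonneg_right (le_max_right _ _) hRm.le
    · calc (R + ‖y₀‖) ^ m ≤ R ^ m := Real.rpow_le_rpow_of_nonpos hR0 (by linarith [norm_nonneg y₀]) hm.le
        _ = 1 * R ^ m := (one_mul _).symm
        _ ≤ max 1 ((1 + ‖y₀‖) ^ m) * R ^ m := mul_le_mul_of_nonneg_right (le_max_left _ _) hRm.le
  calc C * (R + ‖y₀‖) ^ m ≤ max C 0 * (R + ‖y₀‖) ^ m :=
        mul_le_mul_of_nonneg_right (le_max_left _ _) (Real.rpow_nonneg (by linarith [norm_nonneg y₀]) _)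
    _ ≤ max C 0 * (max 1 ((1 + ‖y₀‖) ^ m) * R ^ m) := mul_le_mul_of_nonneg_left hpow (le_max_right _ _)
    _ = max C 0 * max 1 ((1 + ‖y₀‖) ^ m) * R ^ m := by ring

/-- **INVARIANCE OF THE PROFILE UNDER THE RIGID MOTIONS GENERATED BY A KILLING FIELD.**  `U ∈ L¹_loc(ℝ³;ℝ³)` weakly divergence-free with
`∫⁻_{B_R}‖U‖² ≤ C R^{1−2ρ}` (`R ≥ 1`, `ρ > 0`), `B` skew, `b` arbitrary, and `∫ ⟪U, DΦ(z)(Bz + b) − BΦ(z)⟫ = 0` for every smooth compactly supported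
trace-free `Φ`.  Then there are `y₀`, `b′` with `B b′ = 0`, `b = b′ − B y₀`, and for every `θ`:
`exp(−θB) U(exp(θB) z + θ b′ + y₀) = U(z + y₀)` for a.e. `z`. [folklore] -/
theorem killing_invariance (ρ : ℝ) (hρ : 0 < ρ) {U : EuclideanSpace ℝ (Fin 3) → EuclideanSpace ℝ (Fin 3)}
    {B : EuclideanSpace ℝ (Fin 3) →L[ℝ] EuclideanSpace ℝ (Fin 3)} {b : EuclideanSpace ℝ (Fin 3)} {C : ℝ}
    (hB : ∀ x : EuclideanSpace ℝ (Fin 3), ⟪B x, x⟫ = 0) (hUl : LocallyIntegrable U volume)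
    (hgrow : ∀ R : ℝ, 1 ≤ R → ∫⁻ z in ball (0 : EuclideanSpace ℝ (Fin 3)) R, ‖U z‖ₑ ^ 2 ≤ ENNReal.ofReal (C * R ^ (1 - 2 * ρ)))
    (hdivU : ∀ φ : EuclideanSpace ℝ (Fin 3) → ℝ, ContDiff ℝ (⊤ : ℕ∞) φ → HasCompactSupport φ → ∫ z, ⟪U z, gradient φ z⟫ = 0)
    (hshear : ∀ Φ : EuclideanSpace ℝ (Fin 3) → EuclideanSpace ℝ (Fin 3), ContDiff ℝ (⊤ : ℕ∞) Φ → HasCompactSupport Φ →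
      (∀ z, LinearMap.trace ℝ (EuclideanSpace ℝ (Fin 3))
        ((fderiv ℝ Φ z : EuclideanSpace ℝ (Fin 3) →L[ℝ] EuclideanSpace ℝ (Fin 3)) :
          EuclideanSpace ℝ (Fin 3) →ₗ[ℝ] EuclideanSpace ℝ (Fin 3)) = 0) →
      ∫ z, ⟪U z, (fderiv ℝ Φ z) (B z + b) - B (Φ z)⟫ = 0) :
    ∃ y₀ b' : EuclideanSpace ℝ (Fin 3), B b' = 0 ∧ b = b' - B y₀ ∧
      ∀ θ : ℝ, (fun z => NormedSpace.exp ((-θ) • B) (U (NormedSpace.exp (θ • B) z + θ • b' + y₀))) =ᵐ[volume]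
        fun z => U (z + y₀) := by
  obtain ⟨y₀, b', hb', hb⟩ := exists_screw_recentring B hB b
  refine ⟨y₀, b', hb', hb, ?_⟩
  -- the recentred profile `U' = U(· + y₀)` satisfies the hypotheses of the screw lemma with `(B, b')`
  set U' : EuclideanSpace ℝ (Fin 3) → EuclideanSpace ℝ (Fin 3) := fun z => U (z + y₀) with hU'
  have hU'l : LocallyIntegrable U' volume := locallyIntegrable_comp_add_right hUl y₀
  have hgrow' := growth_comp_add hgrow y₀
  have hdivU' : ∀ φ : EuclideanSpace ℝ (Fin 3) → ℝ, ContDiff ℝ (⊤ : ℕ∞) φ → HasCompactSupport φ →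
      ∫ z, ⟪U' z, gradient φ z⟫ = 0 := by
    intro φ hφ hφc
    rw [hU', integral_inner_comp_add_eq U (gradient φ) y₀]
    have hφ' : ContDiff ℝ (⊤ : ℕ∞) (fun x => φ (x - y₀)) := hφ.comp (contDiff_id.sub contDiff_const)
    have hφc' : HasCompactSupport (fun x => φ (x - y₀)) := (isTestFunctionOn_comp_sub ⟨hφ, hφc, by simp⟩ y₀).hasCompactSupport
    have hgr : ∀ z, gradient φ (z - y₀) = gradient (fun x => φ (x - y₀)) z := fun z => by
      rw [gradient, gradient, fderiv_comp_sub]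
    simp_rw [hgr]
    exact hdivU _ hφ' hφc'
  have hshear' : ∀ Φ : EuclideanSpace ℝ (Fin 3) → EuclideanSpace ℝ (Fin 3), ContDiff ℝ (⊤ : ℕ∞) Φ → HasCompactSupport Φ →
      (∀ z, LinearMap.trace ℝ (EuclideanSpace ℝ (Fin 3))
        ((fderiv ℝ Φ z : EuclideanSpace ℝ (Fin 3) →L[ℝ] EuclideanSpace ℝ (Fin 3)) :
          EuclideanSpace ℝ (Fin 3) →ₗ[ℝ] EuclideanSpace ℝ (Fin 3)) = 0) →
      ∫ z, ⟪U' z, (fderiv ℝ Φ z) (B z + b') - B (Φ z)⟫ = 0 := by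
    intro Φ hΦ hΦc htr
    -- translate the test field: `Ψ = Φ(· − y₀)`
    have hΨ : ContDiff ℝ (⊤ : ℕ∞) (fun x => Φ (x - y₀)) := hΦ.comp (contDiff_id.sub contDiff_const)
    have hΨc : HasCompactSupport (fun x => Φ (x - y₀)) := (isTestFunctionOn_comp_sub ⟨hΦ, hΦc, by simp⟩ y₀).hasCompactSupport
    have hΨtr : ∀ z, LinearMap.trace ℝ (EuclideanSpace ℝ (Fin 3))
        ((fderiv ℝ (fun x => Φ (x - y₀)) z : EuclideanSpace ℝ (Fin 3) →L[ℝ] EuclideanSpace ℝ (Fin 3)) :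
          EuclideanSpace ℝ (Fin 3) →ₗ[ℝ] EuclideanSpace ℝ (Fin 3)) = 0 := fun z => by
      rw [fderiv_comp_sub]; exact htr _
    have h := hshear _ hΨ hΨc hΨtr
    rw [hU', integral_inner_comp_add_eq U (fun z => (fderiv ℝ Φ z) (B z + b') - B (Φ z)) y₀]
    have e : (fun z => ⟪U z, (fun z => (fderiv ℝ Φ z) (B z + b') - B (Φ z)) (z - y₀)⟫) =
        fun z => ⟪U z, (fderiv ℝ (fun x => Φ (x - y₀)) z) (B z + b) - B (Φ (z - y₀))⟫ := by
      funext z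
      simp only [fderiv_comp_sub_apply, map_sub, hb]
      congr 2
      abel
    rw [e]
    exact h
  exact screwShearVanishes ρ hρ U' B b' _ hB hb' hU'l hgrow' hdivU' hshear'

end RigidFrame

end Summit.NavierStokesRegularity.NavierStokesRegularity.Theorems.PowerGaugeEulerLiouville

end
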